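import Mathlib
import HarnessLib
import Literature.NumberTheory.LFunctions.VanDerCorputBProcess
import Literature.NumberTheory.LFunctions.ZetaBProcessPhase
import Literature.NumberTheory.LFunctions.VanDerCorputDerivTests

/-!
# The exponent pair `(1/9, 13/18) = ABA²B(0,1)` for `∑ m^{it}`: the `AB` step

Topic `Literature/NumberTheory/LFunctions`. The van der Corput estimate
`∑_{M/2 ≤ m ≤ M} m^{it} ≪ t^{1/9} M^{11/18}` in the range `K^{5/13} ≤ M ≤ K^{1/2}/2`, `K = t/2π`
(Bourgain 2017, eq. (4.2): the exponent pair `(1/9, 13/18) = ABA²B(0,1)`, Titchmarsh §5.20),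
obtained exactly as the notation `ABA²B` prescribes: one Weyl–van der Corput differencing
(`A`, `Literature.NumberTheory.LFunctions.VdC.vanDerCorput_e`), then for each shift `d` the
`B`-process (Titchmarsh Thm 4.9, `Literature.NumberTheory.LFunctions.VdC.vanDerCorput_theorem49`)
applied to `∑ e(φ_d(n))`, `φ_d(y) = K(log y - log(y + d))`, followed by partial summation
(`Literature.NumberTheory.LFunctions.VdC.abel_bound`) and the fourth-derivative test
(`A²B(0,1) = (1/14, 11/14)`, `Literature.NumberTheory.LFunctions.VdC.fourthDerivTest_signed`) for the
dual sums `∑ e(ψ(ν))` (the calculus of `φ_d`, `x_ν`, `ψ` is in `ZetaBProcessPhase.lean`).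

Everything here is PROVED; all constants are explicit (and crude). To keep the exponent
bookkeeping inside `ℚ`-free polynomial arithmetic the bounds are expressed through the roots
`u = (Kd)^{1/140}`, `m = M^{1/10}` (per shift) and `r = M^{1/180}`, `s = K^{1/180}` (Weyl step),
in terms of which every quantity of the method is a monomial:
`λ₂ = Kd/(32M³) = u¹⁴⁰/(32m³⁰)`, `λ₂^{1/2} = u⁷⁰/(32^{1/2}m¹⁵)`, `ℓ = λ₄ = (15/2³³)M⁷/(Kd)³`,
`ℓ^{1/14} = (15/2³³)^{1/14} m⁵/u³⁰`, `(16Kd/M²)^{3/4} = 8u¹⁰⁵/m¹⁵`, `(λ₂λ₃)^{1/5} = u⁵⁶/(2m¹⁴)`,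
and `M^{11/9}K^{2/9} = r²²⁰s⁴⁰`.

## Main results

* `Literature.NumberTheory.LFunctions.VdC.norm_sum_e_dphase_le` — for `1 ≤ d ≤ M/4`, `M² ≤ K/4`,
  `M/4 ≤ a₀ ≤ b₀ ≤ M`:
  `‖∑_{a₀<n≤b₀} e(φ_d(n))‖ ≤ 2⁸⁰ (u⁴⁰ + u⁶⁵/m⁵ + (M³/K)^{1/2} + log(16K) + u⁵⁶/m⁴)`
  (i.e. `≪ (Kd)^{2/7} + (Kd)^{13/28}M^{-1/2} + M^{3/2}K^{-1/2} + log K + (Kd)^{2/5}M^{-2/5}`).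
* `Literature.NumberTheory.LFunctions.VdC.norm_sum_e_phaseD_le_AB` — for `K ≥ 1`, `M ≥ 512`,
  `K^{5/13} ≤ M`, `M² ≤ K/4` and integers `M/4 ≤ j`, `j + M/4 ≤ f ≤ M`:
  `‖∑_{j<n≤f} n^{it}‖ = ‖∑_{j<n≤f} e((t/2π) log n)‖ ≤ 2⁴⁵ M^{11/18} K^{1/9}`.

## References

* J. Bourgain, *Decoupling, exponential sums and the Riemann zeta function*, J. Amer. Math. Soc.
  30 (2017), 205–224, §5 eq. (4.2).
* E. C. Titchmarsh, *The Theory of the Riemann Zeta-Function*, 2nd ed., Thm 4.9, §5.20.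
* S. W. Graham, G. Kolesnik, *Van der Corput's Method of Exponential Sums*, LMS LN 126 (1991),
  Thms 3.8, 3.10 (the `A`- and `B`-processes).
-/

noncomputable section

open Real Set

namespace Literature.NumberTheory.LFunctions
namespace VdC

/-! ### Monomial bookkeeping in the roots `u = (Kd)^{1/140}`, `m = M^{1/10}` -/

/-- `(x^{1/n})^n = x` for `x ≥ 0`. [folklore] -/
theorem rpow_one_div_natCast_pow {x : ℝ} (hx : 0 ≤ x) {n : ℕ} (hn : n ≠ 0) :
    (x ^ (1 / (n : ℝ))) ^ n = x := by
  rw [← Real.rpow_natCast, ← Real.rpow_mul hx, one_div_mul_cancel (Nat.cast_ne_zero.2 hn),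
    Real.rpow_one]

/-- `(x^n)^{1/n} = x` for `x ≥ 0`. [folklore] -/
theorem pow_rpow_one_div_natCast {x : ℝ} (hx : 0 ≤ x) {n : ℕ} (hn : n ≠ 0) :
    (x ^ n) ^ (1 / (n : ℝ)) = x := by
  rw [one_div]
  exact Real.pow_rpow_inv_natCast hx hn

/-- `λ₂^{1/2}`: `(u¹⁴⁰/(32(m¹⁰)³))^{1/2} = u⁷⁰/(32^{1/2} m¹⁵)`. [folklore] -/
theorem sqrt_lam2_eq {u m : ℝ} (hu : 0 < u) (hm : 0 < m) :
    Real.sqrt (u ^ 140 / (32 * (m ^ 10) ^ 3)) = u ^ 70 / (Real.sqrt 32 * m ^ 15) := by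
  have h1 : u ^ 140 / (32 * (m ^ 10) ^ 3) = (u ^ 70 / m ^ 15) ^ 2 / 32 := by
    field_simp
  rw [h1, Real.sqrt_div' _ (by norm_num : (0 : ℝ) ≤ 32), Real.sqrt_sq (by positivity)]
  field_simp

/-- `ℓ^{1/14}`: `(c (m¹⁰)⁷/(u¹⁴⁰)³)^{1/14} = c^{1/14} m⁵/u³⁰` (`c ≥ 0`). [folklore] -/
theorem lam4_rpow_eq {u m c : ℝ} (hu : 0 < u) (hm : 0 < m) (hc : 0 ≤ c) :
    (c * (m ^ 10) ^ 7 / (u ^ 140) ^ 3) ^ (1 / 14 : ℝ) = c ^ (1 / 14 : ℝ) * (m ^ 5 / u ^ 30) := by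
  have h1 : c * (m ^ 10) ^ 7 / (u ^ 140) ^ 3 = c * (m ^ 5 / u ^ 30) ^ 14 := by
    field_simp
  rw [h1, Real.mul_rpow hc (by positivity)]
  congr 1
  rw [show (1 / 14 : ℝ) = 1 / ((14 : ℕ) : ℝ) by norm_num]
  exact pow_rpow_one_div_natCast (by positivity) (by norm_num)

/-- `(16Kd/M²)^{3/4}`: `(16 u¹⁴⁰/(m¹⁰)²)^{3/4} = 8 u¹⁰⁵/m¹⁵`. [folklore] -/
theorem betab_rpow_eq {u m : ℝ} (hu : 0 < u) (hm : 0 < m) :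
    (16 * u ^ 140 / (m ^ 10) ^ 2) ^ (3 / 4 : ℝ) = 8 * (u ^ 105 / m ^ 15) := by
  have h1 : 16 * u ^ 140 / (m ^ 10) ^ 2 = (2 * (u ^ 35 / m ^ 5)) ^ (4 : ℕ) := by
    field_simp; ring
  rw [h1, ← Real.rpow_natCast _ 4, ← Real.rpow_mul (by positivity),
    show ((4 : ℕ) : ℝ) * (3 / 4 : ℝ) = ((3 : ℕ) : ℝ) by norm_num, Real.rpow_natCast]
  ring

/-- `(λ₂λ₃)^{1/5}`: `(u¹⁴⁰/(32(m¹⁰)³) · u¹⁴⁰/(m¹⁰)⁴)^{1/5} = u⁵⁶/(2m¹⁴)`. [folklore] -/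
theorem lam23_rpow_eq {u m : ℝ} (hu : 0 < u) (hm : 0 < m) :
    (u ^ 140 / (32 * (m ^ 10) ^ 3) * (u ^ 140 / (m ^ 10) ^ 4)) ^ (1 / 5 : ℝ) = u ^ 56 / (2 * m ^ 14) := by
  have h1 : u ^ 140 / (32 * (m ^ 10) ^ 3) * (u ^ 140 / (m ^ 10) ^ 4) = (u ^ 56 / (2 * m ^ 14)) ^ 5 := by
    field_simp; ring
  rw [h1, show (1 / 5 : ℝ) = 1 / ((5 : ℕ) : ℝ) by norm_num]
  exact pow_rpow_one_div_natCast (by positivity) (by norm_num)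

/-- `(15/2³³)^{1/14} ≤ 1` and `((15/2³³)^{1/14})⁻¹ ≤ 8`. [folklore] -/
theorem c1_rpow_bounds :
    (15 / 2 ^ 33 : ℝ) ^ (1 / 14 : ℝ) ≤ 1 ∧ ((15 / 2 ^ 33 : ℝ) ^ (1 / 14 : ℝ))⁻¹ ≤ 8 := by
  constructor
  · exact Real.rpow_le_one (by norm_num) (by norm_num) (by norm_num)
  · rw [← Real.rpow_neg (by norm_num)]
    have h1 : (15 / 2 ^ 33 : ℝ) ^ (-(1 / 14 : ℝ)) = ((2 ^ 33 / 15 : ℝ)) ^ (1 / 14 : ℝ) := by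
      rw [Real.rpow_neg (by norm_num), ← Real.inv_rpow (by norm_num)]
      norm_num
    rw [h1]
    have h2 : (2 ^ 33 / 15 : ℝ) ≤ (8 : ℝ) ^ (14 : ℕ) := by norm_num
    calc ((2 ^ 33 / 15 : ℝ)) ^ (1 / 14 : ℝ) ≤ ((8 : ℝ) ^ (14 : ℕ)) ^ (1 / 14 : ℝ) :=
          Real.rpow_le_rpow (by norm_num) h2 (by norm_num)
      _ = 8 := by
          rw [show (1 / 14 : ℝ) = 1 / ((14 : ℕ) : ℝ) by norm_num]
          exact pow_rpow_one_div_natCast (by norm_num) (by norm_num)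

/-- Pure bookkeeping for the main term: with `B₃₂ = 32^{1/2} ≤ 6`, `c ≤ 1`, `c⁻¹ ≤ 8`,
`3 (B₃₂ m¹⁵/u⁷⁰)(768·2⁶⁰)(16u¹⁴⁰/m²⁰ · c m⁵/u³⁰ + 8u¹⁰⁵/m¹⁵ · c⁻¹u³⁰/m⁵) ≤ 2⁸⁰(u⁴⁰ + u⁶⁵/m⁵)`.
[folklore] -/
theorem main_term_pure {u m c B : ℝ} (hu : 0 < u) (hm : 0 < m) (hc : 0 < c) (hc1 : c ≤ 1)
    (hc8 : c⁻¹ ≤ 8) (hB6 : B ≤ 6) :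
    3 * (B * m ^ 15 / u ^ 70 * (768 * 2 ^ 60 *
        (16 * u ^ 140 / (m ^ 10) ^ 2 * (c * (m ^ 5 / u ^ 30))
          + 8 * (u ^ 105 / m ^ 15) * (c⁻¹ * (u ^ 30 / m ^ 5)))))
      ≤ 2 ^ 80 * (u ^ 40 + u ^ 65 / m ^ 5) := by
  have heq : 3 * (B * m ^ 15 / u ^ 70 * (768 * 2 ^ 60 *
        (16 * u ^ 140 / (m ^ 10) ^ 2 * (c * (m ^ 5 / u ^ 30))
          + 8 * (u ^ 105 / m ^ 15) * (c⁻¹ * (u ^ 30 / m ^ 5)))))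
        = 3 * B * 768 * 2 ^ 60 * (16 * c * u ^ 40 + 8 * c⁻¹ * (u ^ 65 / m ^ 5)) := by
    field_simp
  rw [heq]
  set X : ℝ := u ^ 40 with hX
  set Y : ℝ := u ^ 65 / m ^ 5 with hY
  have hX0 : 0 ≤ X := by positivity
  have hY0 : 0 ≤ Y := by positivity
  have hA : 16 * c * X ≤ 16 * X := by
    have h := mul_le_mul_of_nonneg_left hc1 (show (0 : ℝ) ≤ 16 * X by positivity)
    linarith
  have hBB : 8 * c⁻¹ * Y ≤ 64 * Y := by
    have h := mul_le_mul_of_nonneg_left hc8 (show (0 : ℝ) ≤ 8 * Y by positivity)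
    linarith
  have h0 : 0 ≤ 16 * c * X + 8 * c⁻¹ * Y := by positivity
  have h1 : 3 * B * 768 * 2 ^ 60 ≤ 3 * 6 * 768 * 2 ^ 60 := by nlinarith
  calc 3 * B * 768 * 2 ^ 60 * (16 * c * X + 8 * c⁻¹ * Y)
      ≤ 3 * 6 * 768 * 2 ^ 60 * (16 * X + 64 * Y) :=
        mul_le_mul h1 (add_le_add hA hBB) h0 (by positivity)
    _ ≤ 2 ^ 80 * (X + Y) := by linarith

/-! ### The `B`-process for the differenced phase -/

/-- `a ≤ x_ν` as soon as `0 < ν ≤ φ_d'(a)`. [folklore] -/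
theorem le_xsLog_of_le {t d a ν : ℝ} (ht : 0 < t) (hd : 0 < d) (hν : 0 < ν)
    (hνa : ν ≤ dphase t d 1 a) : a ≤ xsLog t d ν := by
  by_contra h
  push Not at h
  have := dphase_one_strictAnti ht hd (xsLog_pos ht hd hν) h
  rw [dphase_one_xsLog ht hd hν] at this
  linarith

/-- `φ_d'(y) = Kd/(y(y+d))`. [folklore] -/
theorem dphase_one_eq_div {t d y : ℝ} (hy : 0 < y) (hyd : 0 < y + d) :
    dphase t d 1 y = t / (2 * π) * d / (y * (y + d)) := by
  rw [dphase_one, inv_sub_inv_add_eq hy hyd]; ring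

section Shift

variable {t M : ℝ} {a₀ b₀ d : ℕ}

/-- The standing hypotheses of the `B`-step for one shift `d`. [folklore] -/
structure ShiftHyp (t M : ℝ) (a₀ b₀ d : ℕ) : Prop where
  ht : 0 < t
  hK1 : 1 ≤ t / (2 * π)
  hM : 4 ≤ M
  ha₀ : M / 4 ≤ a₀
  hb₀ : (b₀ : ℝ) ≤ M
  hab : a₀ ≤ b₀
  hd : 1 ≤ d
  hdM : (d : ℝ) ≤ M / 4
  hMK : M ^ 2 ≤ t / (2 * π) / 4

namespace ShiftHyp

variable (h : ShiftHyp t M a₀ b₀ d)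
include h

/-- `M > 0`. [folklore] -/
theorem hM0 : 0 < M := by linarith [h.hM]
/-- `K = t/2π > 0`. [folklore] -/
theorem hK0 : 0 < t / (2 * π) := by have := h.ht; positivity
/-- `d > 0`. [folklore] -/
theorem hd0 : (0 : ℝ) < d := by have := h.hd; exact_mod_cast this
/-- `a₀ > 0`. [folklore] -/
theorem ha0 : (0 : ℝ) < a₀ := by linarith [h.ha₀, h.hM0]
/-- `a₀ ≤ b₀` in `ℝ`. [folklore] -/
theorem hab' : (a₀ : ℝ) ≤ b₀ := by exact_mod_cast h.hab

/-- Points of `[a₀, b₀]` lie in the box `M/4 ≤ y`, `y + d ≤ 4M`. [folklore] -/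
theorem box_of_mem {y : ℝ} (hy : y ∈ Icc (a₀ : ℝ) b₀) : M / 4 ≤ y ∧ y + d ≤ 4 * M :=
  ⟨h.ha₀.trans hy.1, by linarith [hy.2, h.hb₀, h.hdM, h.hM0]⟩

/-- `α = φ_d'(b₀) ≥ 2`. [folklore] -/
theorem two_le_alpha : 2 ≤ dphase t d 1 b₀ := by
  have hb : (0 : ℝ) < b₀ := h.ha0.trans_le h.hab'
  have hbd : (0 : ℝ) < b₀ + d := by linarith [h.hd0]
  rw [dphase_one_eq_div hb hbd, le_div_iff₀ (mul_pos hb hbd)]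
  have h1 : (b₀ : ℝ) * (b₀ + d) ≤ M * (M + M / 4) :=
    mul_le_mul h.hb₀ (by linarith [h.hb₀, h.hdM]) hbd.le h.hM0.le
  have h2 : 4 * M ^ 2 ≤ t / (2 * π) := by linarith [h.hMK]
  have h3 : t / (2 * π) ≤ t / (2 * π) * d :=
    le_mul_of_one_le_right h.hK0.le (by exact_mod_cast h.hd)
  have h4 := h.hK0
  have h5 := h.hM0
  nlinarith

/-- `β = φ_d'(a₀) ≤ 16Kd/M²`. [folklore] -/
theorem beta_le : dphase t d 1 a₀ ≤ 16 * (t / (2 * π) * d) / M ^ 2 := by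
  have had : (0 : ℝ) < a₀ + d := by linarith [h.ha0, h.hd0]
  rw [dphase_one_eq_div h.ha0 had, div_le_div_iff₀ (mul_pos h.ha0 had) (pow_pos h.hM0 2)]
  have h1 : M / 4 * (M / 4) ≤ (a₀ : ℝ) * (a₀ + d) :=
    mul_le_mul h.ha₀ (by linarith [h.ha₀, h.hd0]) (by linarith [h.hM0]) h.ha0.le
  have h2 : 0 ≤ t / (2 * π) * d := by have := h.hK0; have := h.hd0; positivity
  nlinarith

/-- `α ≤ β`. [folklore] -/
theorem alpha_le_beta : dphase t d 1 b₀ ≤ dphase t d 1 a₀ := by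
  rcases eq_or_lt_of_le h.hab' with heq | hlt
  · rw [show (b₀ : ℝ) = a₀ from heq.symm]
  · exact (dphase_one_strictAnti h.ht h.hd0 h.ha0 hlt).le

/-- `Kd/α = b₀(b₀ + d) ≤ 5M²/4`. [folklore] -/
theorem Kd_div_alpha_le : t / (2 * π) * d / dphase t d 1 b₀ ≤ 5 * M ^ 2 / 4 := by
  have hb : (0 : ℝ) < b₀ := h.ha0.trans_le h.hab'
  have hbd : (0 : ℝ) < b₀ + d := by linarith [h.hd0]
  have hKd : 0 < t / (2 * π) * d := by have := h.hK0; have := h.hd0; positivity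
  rw [dphase_one_eq_div hb hbd, div_div_eq_mul_div, mul_div_cancel_left₀ _ hKd.ne']
  have h1 : (b₀ : ℝ) * (b₀ + d) ≤ M * (M + M / 4) :=
    mul_le_mul h.hb₀ (by linarith [h.hb₀, h.hdM]) hbd.le h.hM0.le
  linarith

/-- For `ν ≥ α/2`, `x_ν + d ≤ 4M`; for `ν ≤ β`, `M/4 ≤ x_ν`: the dual range lies in the box.
[folklore] -/
theorem box_of_dual {ν : ℝ} (hν1 : dphase t d 1 b₀ / 2 ≤ ν) (hν2 : ν ≤ dphase t d 1 a₀) :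
    M / 4 ≤ xsLog t d ν ∧ xsLog t d ν + d ≤ 4 * M := by
  have hα := h.two_le_alpha
  have hν : 0 < ν := by linarith
  constructor
  · exact h.ha₀.trans (le_xsLog_of_le h.ht h.hd0 hν hν2)
  · refine xsLog_add_le h.ht h.hd0 hν h.hM0 h.hdM ?_
    have h1 := h.Kd_div_alpha_le
    have hKd : 0 < t / (2 * π) * d := by have := h.hK0; have := h.hd0; positivity
    calc t / (2 * π) * d / ν ≤ t / (2 * π) * d / (dphase t d 1 b₀ / 2) :=
          div_le_div_of_nonneg_left hKd.le (by linarith) hν1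
      _ = 2 * (t / (2 * π) * d / dphase t d 1 b₀) := by
          field_simp
      _ ≤ 15 * M ^ 2 := by nlinarith [h.hM0]

/-- **Theorem 4.9 for `∑ e(φ_d(n))`** with `λ₂ = Kd/(32M³)`, `λ₃ = Kd/M⁴`, `A = 4096`.
[cite: Titchmarsh1986, Theorem 4.9] -/
theorem bprocess :
    ‖∑ n ∈ Finset.Ioc a₀ b₀, e (dphase t d 0 n)
        - bProcessConst * ∑ ν ∈ Finset.Ioc ⌊dphase t d 1 b₀⌋ ⌊dphase t d 1 a₀⌋,
            (((Real.sqrt (-dphase t d 2 (xsLog t d ν)))⁻¹ : ℝ) : ℂ)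
              * e (dphase t d 0 (xsLog t d ν) - ν * xsLog t d ν)‖
      ≤ 50 * 4096 ^ 2 * (1 / Real.sqrt (t / (2 * π) * d / (32 * M ^ 3))
          + Real.log (((b₀ : ℝ) - a₀) * (t / (2 * π) * d / (32 * M ^ 3)) + 2)
          + ((b₀ : ℝ) - a₀) * ((t / (2 * π) * d / (32 * M ^ 3)) * (t / (2 * π) * d / M ^ 4))
              ^ (1 / 5 : ℝ)) := by
  have ht := h.ht
  have hK0 := h.hK0
  have hd0 := h.hd0
  have hM0 := h.hM0
  have hlam2 : 0 < t / (2 * π) * d / (32 * M ^ 3) := by positivity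
  have hlam3 : 0 < t / (2 * π) * d / M ^ 4 := by positivity
  have hpos : ∀ y ∈ Icc (a₀ : ℝ) b₀, 0 < y := fun y hy => h.ha0.trans_le hy.1
  have key := vanDerCorput_theorem49 (f := dphase t d 0) (f' := dphase t d 1)
    (f'' := dphase t d 2) (f''' := dphase t d 3) (a := (a₀ : ℝ)) (b := (b₀ : ℝ))
    (lam2 := t / (2 * π) * d / (32 * M ^ 3)) (lam3 := t / (2 * π) * d / M ^ 4) (A := 4096)
    (xs := fun ν : ℤ => xsLog t d ν) (Nat.cast_nonneg a₀) h.hab' hlam2 hlam3 (by norm_num)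
    (fun y hy => hasDerivAt_dphase t hd0.le (hpos y hy) 0)
    (fun y hy => hasDerivAt_dphase t hd0.le (hpos y hy) 1)
    (fun y hy => hasDerivAt_dphase t hd0.le (hpos y hy) 2)
    (fun y hy => by
      obtain ⟨hy1, hy2⟩ := h.box_of_mem hy
      have hb := neg_dphase_two_bounds ht hM0 hy1 hy2 hd0.le
      refine ⟨hb.1, hb.2.trans (le_of_eq ?_)⟩
      field_simp
      ring)
    (fun y hy => by
      obtain ⟨hy1, hy2⟩ := h.box_of_mem hy
      have hb := dphase_three_bounds ht hM0 hy1 hy2 hd0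
      rw [abs_of_pos hb.1]
      refine hb.2.trans ?_
      nlinarith [hlam3])
    (fun ν hνb hνa => by
      have hb : (0 : ℝ) < b₀ := h.ha0.trans_le h.hab'
      have hαpos : 0 < dphase t d 1 b₀ := by linarith [h.two_le_alpha]
      have hν : (0 : ℝ) < ν := hαpos.trans hνb
      exact ⟨xsLog_mem_Icc ht hd0 h.ha0 hνb hνa h.hab', dphase_one_xsLog ht hd0 hν⟩)
  simp only [Nat.floor_natCast] at key
  exact key

/-- **The fourth-derivative test for the dual sums**: for `⌊α⌋ < x ≤ β`,
`‖∑_{⌊α⌋<n≤x} e(ψ(n))‖ ≤ 768·2⁶⁰ (βb ℓ^{1/14} + βb^{3/4} ℓ^{-1/14})` with `βb = 16Kd/M²`,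
`ℓ = (15/2³³) M⁷/(Kd)³` (the size of the fourth derivative of `ψ`).
[cite: Titchmarsh1986, Thm 5.13, §5.20] -/
theorem dual_partial_le (x : ℕ) (hNx : ⌊dphase t d 1 b₀⌋₊ < x) (hxβ : (x : ℝ) ≤ dphase t d 1 a₀) :
    ‖∑ n ∈ Finset.Ioc ⌊dphase t d 1 b₀⌋₊ x, e (dualFamily t d 0 n)‖
      ≤ 768 * 2 ^ 60 * (16 * (t / (2 * π) * d) / M ^ 2
            * (15 / 2 ^ 33 * (M ^ 7 / (t / (2 * π) * d) ^ 3)) ^ (1 / 14 : ℝ)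
          + (16 * (t / (2 * π) * d) / M ^ 2) ^ (3 / 4 : ℝ)
            * (15 / 2 ^ 33 * (M ^ 7 / (t / (2 * π) * d) ^ 3)) ^ (-(1 / 14 : ℝ))) := by
  have ht := h.ht
  have hK0 := h.hK0
  have hd0 := h.hd0
  have hM0 := h.hM0
  set α : ℝ := dphase t d 1 b₀ with hα
  set β : ℝ := dphase t d 1 a₀ with hβ
  set N : ℕ := ⌊α⌋₊ with hN
  set ℓ : ℝ := 15 / 2 ^ 33 * (M ^ 7 / (t / (2 * π) * d) ^ 3) with hℓ
  set βb : ℝ := 16 * (t / (2 * π) * d) / M ^ 2 with hβb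
  have hα2 : 2 ≤ α := h.two_le_alpha
  have hN2 : 2 ≤ N := Nat.le_floor (by exact_mod_cast hα2)
  have hNpos : (0 : ℝ) < N := by exact_mod_cast (show 0 < N by omega)
  have hNα : α < N + 1 := Nat.lt_floor_add_one α
  have hℓpos : 0 < ℓ := by positivity
  have hβb : β ≤ βb := h.beta_le
  -- the sum in `ℤ`-indexed form
  have hsum : ∑ n ∈ Finset.Ioc N x, e (dualFamily t d 0 n)
      = ∑ n ∈ Finset.Ioc (N : ℤ) (x : ℤ), e (dualFamily t d 0 n) := by
    rw [sum_Ioc_int_eq_nat (fun n : ℤ => e (dualFamily t d 0 n)) N x]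
    simp only [Int.cast_natCast]
  rw [hsum]
  have hD : DerivFamily (dualFamily t d) ((N : ℤ) : ℝ) ((x : ℤ) : ℝ) 4 :=
    dualFamily_derivFamily ht hd0 (by push_cast; exact hNpos)
  have hbound : ∀ y ∈ Icc ((N : ℤ) : ℝ) ((x : ℤ) : ℝ),
      ℓ ≤ 1 * dualFamily t d 4 y ∧ 1 * dualFamily t d 4 y ≤ 2 ^ 60 * ℓ := by
    intro y hy
    push_cast at hy
    have hy1 : α / 2 ≤ y := by linarith [hy.1]
    have hy2 : y ≤ β := hy.2.trans hxβ
    obtain ⟨hb1, hb2⟩ := h.box_of_dual hy1 hy2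
    have hb := dual_fourth_bounds ht hM0 hb1 hb2 hd0
    rw [one_mul, dualFamily_four]
    refine ⟨hb.1, hb.2.trans (le_of_eq ?_)⟩
    rw [hℓ]
    ring
  have h4 := fourthDerivTest_signed (h := 2 ^ 60) (by norm_num) (Or.inl rfl) hℓpos
    (a := (N : ℤ)) (b := (x : ℤ)) (by exact_mod_cast hNx) hD hbound
  refine h4.trans ?_
  have hxN0 : (0 : ℝ) ≤ ((x : ℤ) : ℝ) - ((N : ℤ) : ℝ) := by
    push_cast
    have : (N : ℝ) < x := by exact_mod_cast hNx
    linarith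
  have hxN : ((x : ℤ) : ℝ) - ((N : ℤ) : ℝ) ≤ βb := by
    push_cast
    linarith
  have hβb0 : 0 ≤ βb := hxN0.trans hxN
  apply mul_le_mul_of_nonneg_left _ (by norm_num)
  apply add_le_add
  · exact mul_le_mul_of_nonneg_right hxN (by positivity)
  · exact mul_le_mul_of_nonneg_right (Real.rpow_le_rpow hxN0 hxN (by norm_num)) (by positivity)

/-- **Partial summation for the main term of the `B`-process**: with the non-increasing
weights `w(ν) = |φ''(x_ν)|^{-1/2} ≤ λ₂^{-1/2}`,
`‖∑_{α<ν≤β} w(ν) e(ψ(ν))‖ ≤ λ₂^{-1/2} · max_x ‖∑_{⌊α⌋<n≤x} e(ψ(n))‖`.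
[cite: GrahamKolesnik1991, proof of Theorem 3.10] -/
theorem dual_main_le :
    ‖∑ ν ∈ Finset.Ioc ⌊dphase t d 1 b₀⌋ ⌊dphase t d 1 a₀⌋,
        (((Real.sqrt (-dphase t d 2 (xsLog t d ν)))⁻¹ : ℝ) : ℂ)
          * e (dphase t d 0 (xsLog t d ν) - ν * xsLog t d ν)‖
      ≤ (1 / Real.sqrt (t / (2 * π) * d / (32 * M ^ 3)))
        * (768 * 2 ^ 60 * (16 * (t / (2 * π) * d) / M ^ 2
            * (15 / 2 ^ 33 * (M ^ 7 / (t / (2 * π) * d) ^ 3)) ^ (1 / 14 : ℝ)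
          + (16 * (t / (2 * π) * d) / M ^ 2) ^ (3 / 4 : ℝ)
            * (15 / 2 ^ 33 * (M ^ 7 / (t / (2 * π) * d) ^ 3)) ^ (-(1 / 14 : ℝ)))) := by
  have ht := h.ht
  have hK0 := h.hK0
  have hd0 := h.hd0
  have hM0 := h.hM0
  set α : ℝ := dphase t d 1 b₀ with hα
  set β : ℝ := dphase t d 1 a₀ with hβ
  set B : ℝ := 768 * 2 ^ 60 * (16 * (t / (2 * π) * d) / M ^ 2
            * (15 / 2 ^ 33 * (M ^ 7 / (t / (2 * π) * d) ^ 3)) ^ (1 / 14 : ℝ)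
          + (16 * (t / (2 * π) * d) / M ^ 2) ^ (3 / 4 : ℝ)
            * (15 / 2 ^ 33 * (M ^ 7 / (t / (2 * π) * d) ^ 3)) ^ (-(1 / 14 : ℝ))) with hB
  set lam2 : ℝ := t / (2 * π) * d / (32 * M ^ 3) with hlam2
  have hlam2pos : 0 < lam2 := by positivity
  have hα2 : 2 ≤ α := h.two_le_alpha
  have hα0 : 0 ≤ α := by linarith
  have hαβ : α ≤ β := h.alpha_le_beta
  have hβ0 : 0 ≤ β := hα0.trans hαβ
  have hB0 : 0 ≤ B := by
    have : 0 ≤ 16 * (t / (2 * π) * d) / M ^ 2 := by positivity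
    positivity
  set N : ℕ := ⌊α⌋₊ with hN
  set Nb : ℕ := ⌊β⌋₊ with hNb
  have hNz : (⌊α⌋ : ℤ) = (N : ℤ) := (Int.natCast_floor_eq_floor hα0).symm
  have hNbz : (⌊β⌋ : ℤ) = (Nb : ℤ) := (Int.natCast_floor_eq_floor hβ0).symm
  have hN2 : 2 ≤ N := Nat.le_floor (by exact_mod_cast hα2)
  have hNα : α < N + 1 := Nat.lt_floor_add_one α
  have hNbβ : (Nb : ℝ) ≤ β := Nat.floor_le hβ0
  rw [hNz, hNbz, sum_Ioc_int_eq_nat]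
  simp only [Int.cast_natCast]
  rcases le_or_gt Nb N with hle | hlt
  · rw [Finset.Ioc_eq_empty (by omega), Finset.sum_empty, norm_zero]
    positivity
  · obtain ⟨mm, hmm⟩ : ∃ mm, Nb = N + mm := ⟨Nb - N, by omega⟩
    rw [hmm]
    have hpart : ∀ x, N < x → x ≤ N + mm →
        ‖∑ n ∈ Finset.Ioc N x, e (dualFamily t d 0 n)‖ ≤ B := by
      intro x hx1 hx2
      refine h.dual_partial_le x hx1 ?_
      have : (x : ℝ) ≤ Nb := by rw [hmm]; exact_mod_cast hx2
      exact this.trans hNbβ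
    have hab := abel_bound (fun n => e (dualFamily t d 0 n)) N hB0 mm
      (fun n => (Real.sqrt (-dphase t d 2 (xsLog t d n)))⁻¹)
      (fun n₁ n₂ h1 h12 _ => weight_antitone ht hd0
        (by exact_mod_cast (show 0 < n₁ by omega)) (by exact_mod_cast h12))
      (fun n _ _ => inv_nonneg.2 (Real.sqrt_nonneg _)) (inv_nonneg.2 (Real.sqrt_nonneg _)) hpart
    have hform : ∑ n ∈ Finset.Ioc N (N + mm),
        (((Real.sqrt (-dphase t d 2 (xsLog t d n)))⁻¹ : ℝ) : ℂ)
          * e (dphase t d 0 (xsLog t d n) - n * xsLog t d n)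
        = ∑ n ∈ Finset.Ioc N (N + mm),
          (((Real.sqrt (-dphase t d 2 (xsLog t d n)))⁻¹ : ℝ) : ℂ) * e (dualFamily t d 0 n) := by
      rfl
    rw [hform]
    refine hab.trans (mul_le_mul_of_nonneg_right ?_ hB0)
    -- `w(N+1) ≤ λ₂^{-1/2}`: `x_{N+1} ∈ [a₀, b₀]`
    have hν1 : α < ((N + 1 : ℕ) : ℝ) := by push_cast; exact hNα
    have hν2 : ((N + 1 : ℕ) : ℝ) ≤ β := by
      have : ((N + 1 : ℕ) : ℝ) ≤ Nb := by exact_mod_cast (show N + 1 ≤ Nb by omega)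
      exact this.trans hNbβ
    have hxI := xsLog_mem_Icc ht hd0 h.ha0 hν1 hν2 h.hab'
    obtain ⟨hb1, hb2⟩ := h.box_of_mem hxI
    have hlow := (neg_dphase_two_bounds ht hM0 hb1 hb2 hd0.le).1
    show (Real.sqrt (-dphase t d 2 (xsLog t d ((N + 1 : ℕ) : ℝ))))⁻¹ ≤ 1 / Real.sqrt lam2
    rw [one_div]
    exact inv_anti₀ (Real.sqrt_pos.2 hlam2pos) (Real.sqrt_le_sqrt hlow)

/-- **The main term of the `B`-process for one shift**, in the roots `u = (Kd)^{1/140}`,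
`m = M^{1/10}`: `3‖∑_{α<ν≤β} w(ν) e(ψ(ν))‖ ≤ 2⁸⁰ (u⁴⁰ + u⁶⁵/m⁵)` (the pair `BA²B(0,1) = (2/7, 4/7)`
for the differenced sum plus the secondary term of the fourth-derivative test).
[cite: Titchmarsh1986, §5.20] -/
theorem norm_main_le :
    3 * ‖∑ ν ∈ Finset.Ioc ⌊dphase t d 1 b₀⌋ ⌊dphase t d 1 a₀⌋,
        (((Real.sqrt (-dphase t d 2 (xsLog t d ν)))⁻¹ : ℝ) : ℂ)
          * e (dphase t d 0 (xsLog t d ν) - ν * xsLog t d ν)‖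
      ≤ 2 ^ 80 * (((t / (2 * π) * d) ^ (1 / 140 : ℝ)) ^ 40
          + ((t / (2 * π) * d) ^ (1 / 140 : ℝ)) ^ 65 / (M ^ (1 / 10 : ℝ)) ^ 5) := by
  have hmain := h.dual_main_le
  have hKd : 0 < t / (2 * π) * d := by have := h.hK0; have := h.hd0; positivity
  have hM0 := h.hM0
  set u : ℝ := (t / (2 * π) * d) ^ (1 / 140 : ℝ) with hu
  set m : ℝ := M ^ (1 / 10 : ℝ) with hm
  have hu0 : 0 < u := Real.rpow_pos_of_pos hKd _
  have hm0 : 0 < m := Real.rpow_pos_of_pos hM0 _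
  have hu140 : u ^ 140 = t / (2 * π) * d := by
    rw [hu, show (1 / 140 : ℝ) = 1 / ((140 : ℕ) : ℝ) by norm_num]
    exact rpow_one_div_natCast_pow hKd.le (by norm_num)
  have hm10 : m ^ 10 = M := by
    rw [hm, show (1 / 10 : ℝ) = 1 / ((10 : ℕ) : ℝ) by norm_num]
    exact rpow_one_div_natCast_pow hM0.le (by norm_num)
  rw [← hu140, ← hm10] at hmain
  set c : ℝ := (15 / 2 ^ 33 : ℝ) ^ (1 / 14 : ℝ) with hc
  have hc0 : 0 < c := Real.rpow_pos_of_pos (by norm_num) _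
  obtain ⟨hc1, hc8⟩ := c1_rpow_bounds
  have e_sqrt : 1 / Real.sqrt (u ^ 140 / (32 * (m ^ 10) ^ 3)) = Real.sqrt 32 * m ^ 15 / u ^ 70 := by
    rw [sqrt_lam2_eq hu0 hm0]
    have : Real.sqrt 32 ≠ 0 := (Real.sqrt_pos.2 (by norm_num)).ne'
    field_simp
  have e_ℓ : 15 / 2 ^ 33 * ((m ^ 10) ^ 7 / (u ^ 140) ^ 3) = 15 / 2 ^ 33 * (m ^ 10) ^ 7 / (u ^ 140) ^ 3 := by
    ring
  have e_ℓ14 : (15 / 2 ^ 33 * ((m ^ 10) ^ 7 / (u ^ 140) ^ 3)) ^ (1 / 14 : ℝ) = c * (m ^ 5 / u ^ 30) := by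
    rw [e_ℓ]; exact lam4_rpow_eq hu0 hm0 (by norm_num)
  have e_ℓ14' : (15 / 2 ^ 33 * ((m ^ 10) ^ 7 / (u ^ 140) ^ 3)) ^ (-(1 / 14 : ℝ))
      = c⁻¹ * (u ^ 30 / m ^ 5) := by
    rw [Real.rpow_neg (by positivity), e_ℓ14]
    field_simp
  have e_βb34 : (16 * u ^ 140 / (m ^ 10) ^ 2) ^ (3 / 4 : ℝ) = 8 * (u ^ 105 / m ^ 15) :=
    betab_rpow_eq hu0 hm0
  rw [e_sqrt, e_ℓ14, e_ℓ14', e_βb34] at hmain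
  have hs6 : Real.sqrt 32 ≤ 6 := by
    rw [show (6 : ℝ) = Real.sqrt (6 ^ 2) by rw [Real.sqrt_sq (by norm_num)]]
    exact Real.sqrt_le_sqrt (by norm_num)
  have hfin := main_term_pure hu0 hm0 hc0 hc1 hc8 hs6
  exact le_trans (mul_le_mul_of_nonneg_left hmain (by norm_num)) hfin

/-- **The errors of Theorem 4.9 for one shift**, in the roots `u`, `m`:
`50·4096²(λ₂^{-1/2} + log((b₀-a₀)λ₂ + 2) + (b₀-a₀)(λ₂λ₃)^{1/5}) ≤ 2⁸⁰((M³/K)^{1/2} + log(16K) + u⁵⁶/m⁴)`.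
[cite: Titchmarsh1986, Theorem 4.9] -/
theorem norm_err_le :
    50 * 4096 ^ 2 * (1 / Real.sqrt (t / (2 * π) * d / (32 * M ^ 3))
        + Real.log (((b₀ : ℝ) - a₀) * (t / (2 * π) * d / (32 * M ^ 3)) + 2)
        + ((b₀ : ℝ) - a₀) * ((t / (2 * π) * d / (32 * M ^ 3)) * (t / (2 * π) * d / M ^ 4))
            ^ (1 / 5 : ℝ))
      ≤ 2 ^ 80 * (Real.sqrt (M ^ 3 / (t / (2 * π))) + Real.log (16 * (t / (2 * π)))
          + ((t / (2 * π) * d) ^ (1 / 140 : ℝ)) ^ 56 / (M ^ (1 / 10 : ℝ)) ^ 4) := by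
  have ht := h.ht
  have hK0 := h.hK0
  have hK1 := h.hK1
  have hd0 := h.hd0
  have hM0 := h.hM0
  have hKd : 0 < t / (2 * π) * d := by positivity
  set u : ℝ := (t / (2 * π) * d) ^ (1 / 140 : ℝ) with hu
  set m : ℝ := M ^ (1 / 10 : ℝ) with hm
  have hu0 : 0 < u := Real.rpow_pos_of_pos hKd _
  have hm0 : 0 < m := Real.rpow_pos_of_pos hM0 _
  have hu140 : u ^ 140 = t / (2 * π) * d := by
    rw [hu, show (1 / 140 : ℝ) = 1 / ((140 : ℕ) : ℝ) by norm_num]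
    exact rpow_one_div_natCast_pow hKd.le (by norm_num)
  have hm10 : m ^ 10 = M := by
    rw [hm, show (1 / 10 : ℝ) = 1 / ((10 : ℕ) : ℝ) by norm_num]
    exact rpow_one_div_natCast_pow hM0.le (by norm_num)
  set lam2 : ℝ := t / (2 * π) * d / (32 * M ^ 3) with hlam2
  set lam3 : ℝ := t / (2 * π) * d / M ^ 4 with hlam3
  have hlam2pos : 0 < lam2 := by positivity
  -- `1/√λ₂ ≤ 6 √(M³/K)`
  have hT1 : 1 / Real.sqrt lam2 ≤ 6 * Real.sqrt (M ^ 3 / (t / (2 * π))) := by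
    have h1 : 1 / Real.sqrt lam2 ≤ Real.sqrt 32 * Real.sqrt (M ^ 3 / (t / (2 * π))) := by
      rw [← Real.sqrt_mul (by norm_num), one_div, ← Real.sqrt_inv]
      apply Real.sqrt_le_sqrt
      rw [hlam2, inv_div, div_le_iff₀ hKd]
      have hd1 : (1 : ℝ) ≤ d := by exact_mod_cast h.hd
      rw [show 32 * (M ^ 3 / (t / (2 * π))) * (t / (2 * π) * d) = 32 * M ^ 3 * d by
        field_simp]
      nlinarith [pow_pos hM0 3]
    have hs6 : Real.sqrt 32 ≤ 6 := by
      rw [show (6 : ℝ) = Real.sqrt (6 ^ 2) by rw [Real.sqrt_sq (by norm_num)]]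
      exact Real.sqrt_le_sqrt (by norm_num)
    exact h1.trans (mul_le_mul_of_nonneg_right hs6 (Real.sqrt_nonneg _))
  -- the logarithm
  have hba : 0 ≤ (b₀ : ℝ) - a₀ := by linarith [h.hab']
  have hbaM : (b₀ : ℝ) - a₀ ≤ M := by linarith [h.hb₀, h.ha0]
  have hT2 : Real.log (((b₀ : ℝ) - a₀) * lam2 + 2) ≤ Real.log (16 * (t / (2 * π))) := by
    apply Real.log_le_log (by positivity)
    have h1 : ((b₀ : ℝ) - a₀) * lam2 ≤ M * lam2 := mul_le_mul_of_nonneg_right hbaM hlam2pos.le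
    have h2 : M * lam2 ≤ t / (2 * π) := by
      rw [hlam2, show M * (t / (2 * π) * d / (32 * M ^ 3)) = t / (2 * π) * (d / (32 * M ^ 2)) by
        field_simp]
      apply mul_le_of_le_one_right hK0.le
      rw [div_le_one (by positivity)]
      nlinarith [h.hdM, h.hM]
    linarith
  -- the `(λ₂λ₃)^{1/5}` term
  have hT3 : ((b₀ : ℝ) - a₀) * (lam2 * lam3) ^ (1 / 5 : ℝ) ≤ u ^ 56 / m ^ 4 := by
    have e_23 : (lam2 * lam3) ^ (1 / 5 : ℝ) = u ^ 56 / (2 * m ^ 14) := by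
      rw [show lam2 = u ^ 140 / (32 * (m ^ 10) ^ 3) by rw [hu140, hm10],
        show lam3 = u ^ 140 / (m ^ 10) ^ 4 by rw [hu140, hm10]]
      exact lam23_rpow_eq hu0 hm0
    rw [e_23]
    calc ((b₀ : ℝ) - a₀) * (u ^ 56 / (2 * m ^ 14)) ≤ M * (u ^ 56 / (2 * m ^ 14)) :=
          mul_le_mul_of_nonneg_right hbaM (by positivity)
      _ = u ^ 56 / (2 * m ^ 4) := by rw [← hm10]; field_simp
      _ ≤ u ^ 56 / m ^ 4 := by
          rw [div_le_div_iff₀ (by positivity) (by positivity)]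
          nlinarith [pow_pos hm0 4, pow_nonneg hu0.le 56]
  have hX0 : 0 ≤ Real.sqrt (M ^ 3 / (t / (2 * π))) := Real.sqrt_nonneg _
  have hL0 : 0 ≤ Real.log (16 * (t / (2 * π))) := Real.log_nonneg (by linarith)
  have hY0 : 0 ≤ u ^ 56 / m ^ 4 := by positivity
  have hsum : 1 / Real.sqrt lam2 + Real.log (((b₀ : ℝ) - a₀) * lam2 + 2)
      + ((b₀ : ℝ) - a₀) * (lam2 * lam3) ^ (1 / 5 : ℝ)
      ≤ 6 * Real.sqrt (M ^ 3 / (t / (2 * π))) + Real.log (16 * (t / (2 * π))) + u ^ 56 / m ^ 4 :=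
    add_le_add (add_le_add hT1 hT2) hT3
  calc 50 * 4096 ^ 2 * (1 / Real.sqrt lam2 + Real.log (((b₀ : ℝ) - a₀) * lam2 + 2)
        + ((b₀ : ℝ) - a₀) * (lam2 * lam3) ^ (1 / 5 : ℝ))
      ≤ 50 * 4096 ^ 2 * (6 * Real.sqrt (M ^ 3 / (t / (2 * π))) + Real.log (16 * (t / (2 * π)))
        + u ^ 56 / m ^ 4) := mul_le_mul_of_nonneg_left hsum (by norm_num)
    _ ≤ 2 ^ 80 * (Real.sqrt (M ^ 3 / (t / (2 * π))) + Real.log (16 * (t / (2 * π)))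
        + u ^ 56 / m ^ 4) := by linarith

/-- **The `B`-processed estimate for one shift**: for `1 ≤ d ≤ M/4`, `M² ≤ K/4`, `K ≥ 1`,
`M/4 ≤ a₀ ≤ b₀ ≤ M`, with `u = (Kd)^{1/140}`, `m = M^{1/10}`:
`‖∑_{a₀<n≤b₀} e(φ_d(n))‖ ≤ 2⁸⁰ (u⁴⁰ + u⁶⁵/m⁵ + (M³/K)^{1/2} + log(16K) + u⁵⁶/m⁴)`, i.e.
`≪ (Kd)^{2/7} + (Kd)^{13/28}M^{-1/2} + M^{3/2}K^{-1/2} + log K + (Kd)^{2/5}M^{-2/5}`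
(the pair `BA²B(0,1) = (2/7, 4/7)`: `(Kd/M²)^{2/7} M^{4/7} = (Kd)^{2/7}`, plus the secondary term
of the fourth-derivative test and the errors of Theorem 4.9). [cite: Titchmarsh1986, §5.20] -/
theorem norm_sum_le :
    ‖∑ n ∈ Finset.Ioc a₀ b₀, e (dphase t d 0 n)‖
      ≤ 2 ^ 80 * (((t / (2 * π) * d) ^ (1 / 140 : ℝ)) ^ 40
          + ((t / (2 * π) * d) ^ (1 / 140 : ℝ)) ^ 65 / (M ^ (1 / 10 : ℝ)) ^ 5
          + Real.sqrt (M ^ 3 / (t / (2 * π))) + Real.log (16 * (t / (2 * π)))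
          + ((t / (2 * π) * d) ^ (1 / 140 : ℝ)) ^ 56 / (M ^ (1 / 10 : ℝ)) ^ 4) := by
  have h49 := h.bprocess
  have hmain := h.norm_main_le
  have herr := h.norm_err_le
  set S : ℂ := ∑ n ∈ Finset.Ioc a₀ b₀, e (dphase t d 0 n) with hS
  set MS : ℂ := ∑ ν ∈ Finset.Ioc ⌊dphase t d 1 b₀⌋ ⌊dphase t d 1 a₀⌋,
    (((Real.sqrt (-dphase t d 2 (xsLog t d ν)))⁻¹ : ℝ) : ℂ)
      * e (dphase t d 0 (xsLog t d ν) - ν * xsLog t d ν) with hMS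
  have hsplit : ‖S‖ ≤ ‖S - bProcessConst * MS‖ + 3 * ‖MS‖ := by
    calc ‖S‖ = ‖(S - bProcessConst * MS) + bProcessConst * MS‖ := by rw [sub_add_cancel]
      _ ≤ ‖S - bProcessConst * MS‖ + ‖bProcessConst * MS‖ := norm_add_le _ _
      _ ≤ ‖S - bProcessConst * MS‖ + 3 * ‖MS‖ := by
          rw [norm_mul]
          have := mul_le_mul_of_nonneg_right norm_bProcessConst_le (norm_nonneg MS)
          linarith
  have hE := h49.trans herr
  linarith

end ShiftHyp

/-- **The `B`-processed estimate for one shift** (unbundled form of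
`Literature.NumberTheory.LFunctions.VdC.ShiftHyp.norm_sum_le`). [cite: Titchmarsh1986, §5.20] -/
theorem norm_sum_e_dphase_le {t M : ℝ} {a₀ b₀ d : ℕ} (ht : 0 < t) (hK1 : 1 ≤ t / (2 * π))
    (hM : 4 ≤ M) (ha₀ : M / 4 ≤ a₀) (hb₀ : (b₀ : ℝ) ≤ M) (hab : a₀ ≤ b₀) (hd : 1 ≤ d)
    (hdM : (d : ℝ) ≤ M / 4) (hMK : M ^ 2 ≤ t / (2 * π) / 4) :
    ‖∑ n ∈ Finset.Ioc a₀ b₀, e (dphase t d 0 n)‖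
      ≤ 2 ^ 80 * (((t / (2 * π) * d) ^ (1 / 140 : ℝ)) ^ 40
          + ((t / (2 * π) * d) ^ (1 / 140 : ℝ)) ^ 65 / (M ^ (1 / 10 : ℝ)) ^ 5
          + Real.sqrt (M ^ 3 / (t / (2 * π))) + Real.log (16 * (t / (2 * π)))
          + ((t / (2 * π) * d) ^ (1 / 140 : ℝ)) ^ 56 / (M ^ (1 / 10 : ℝ)) ^ 4) :=
  ShiftHyp.norm_sum_le ⟨ht, hK1, hM, ha₀, hb₀, hab, hd, hdM, hMK⟩

end Shift

/-! ### The Weyl step -/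

/-- `⌊x⌋₊ ≥ x/2` for `x ≥ 1`. [folklore] -/
theorem half_le_natFloor {x : ℝ} (hx : 1 ≤ x) : x / 2 ≤ ⌊x⌋₊ := by
  have h1 : (1 : ℝ) ≤ ⌊x⌋₊ := by exact_mod_cast Nat.le_floor (by exact_mod_cast hx)
  have h2 : x < ⌊x⌋₊ + 1 := Nat.lt_floor_add_one x
  linarith

/-- The differenced sums of `vanDerCorput_e` for `f(y) = (t/2π) log y` are the sums
`∑ e(φ_d(n))` up to conjugation. [folklore] -/
theorem norm_diff_sum_eq {t : ℝ} {j f dn : ℕ} (hdf : dn ≤ f) :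
    ‖∑ n ∈ Finset.Ioc (j : ℤ) ((f : ℤ) - dn),
        e (phaseD (-t) 0 ((n + dn : ℤ)) - phaseD (-t) 0 n)‖
      = ‖∑ n ∈ Finset.Ioc j (f - dn), e (dphase t dn 0 n)‖ := by
  have hcast : ((f : ℤ) - dn) = ((f - dn : ℕ) : ℤ) := by push_cast [Nat.cast_sub hdf]; ring
  rw [hcast, sum_Ioc_int_eq_nat (fun n : ℤ => e (phaseD (-t) 0 ((n + dn : ℤ)) - phaseD (-t) 0 n))
    j (f - dn)]
  have h1 : ∑ n ∈ Finset.Ioc j (f - dn),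
      (fun n : ℤ => e (phaseD (-t) 0 ((n + dn : ℤ)) - phaseD (-t) 0 n)) (n : ℤ)
      = ∑ n ∈ Finset.Ioc j (f - dn), (starRingEnd ℂ) (e (dphase t dn 0 n)) := by
    refine Finset.sum_congr rfl fun n _ => ?_
    beta_reduce
    rw [← e_neg]
    congr 1
    simp only [dphase]
    push_cast
    ring
  rw [h1, ← map_sum, RCLike.norm_conj]

/-- Each differenced sum of the Weyl step, bounded in the roots `r = M^{1/180}`, `s = K^{1/180}`
(`u ≤ rs`, `m = r¹⁸`). [folklore] -/
theorem norm_diff_sum_le {t M r s : ℝ} {j f dn : ℕ} (ht : 0 < t) (hK1 : 1 ≤ t / (2 * π))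
    (hM : 4 ≤ M) (hMK : M ^ 2 ≤ t / (2 * π) / 4) (hj : M / 4 ≤ j) (hfM : (f : ℝ) ≤ M)
    (hdn1 : 1 ≤ dn) (hdnM : (dn : ℝ) ≤ M / 4) (hdnf : (j : ℝ) + dn ≤ f)
    (hr : 0 < r) (hs : 0 < s) (hr180 : r ^ 180 = M)
    (hurs : (t / (2 * π) * dn) ^ (1 / 140 : ℝ) ≤ r * s) :
    ‖∑ n ∈ Finset.Ioc (j : ℤ) ((f : ℤ) - dn),
        e (phaseD (-t) 0 ((n + dn : ℤ)) - phaseD (-t) 0 n)‖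
      ≤ 2 ^ 80 * ((r * s) ^ 40 + (r * s) ^ 65 / r ^ 90 + Real.sqrt (M ^ 3 / (t / (2 * π)))
        + Real.log (16 * (t / (2 * π))) + (r * s) ^ 56 / r ^ 72) := by
  have hM0 : 0 < M := by linarith
  have hdnf' : dn ≤ f := by
    have : (dn : ℝ) ≤ f := by linarith [Nat.cast_nonneg (α := ℝ) j]
    exact_mod_cast this
  rw [norm_diff_sum_eq hdnf']
  have hb₀ : ((f - dn : ℕ) : ℝ) ≤ M := by
    rw [Nat.cast_sub hdnf']; linarith [Nat.cast_nonneg (α := ℝ) dn]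
  have hab : j ≤ f - dn := by
    have h2 : j + dn ≤ f := by exact_mod_cast hdnf
    omega
  have hkey := norm_sum_e_dphase_le (a₀ := j) (b₀ := f - dn) (d := dn) ht hK1 hM
    hj hb₀ hab hdn1 hdnM hMK
  refine hkey.trans (mul_le_mul_of_nonneg_left ?_ (by norm_num))
  have hKd : 0 < t / (2 * π) * dn := by positivity
  have hu0 : 0 ≤ (t / (2 * π) * dn) ^ (1 / 140 : ℝ) := Real.rpow_nonneg hKd.le _
  have hm : M ^ (1 / 10 : ℝ) = r ^ 18 := by
    rw [← hr180, show (r ^ 180) = (r ^ 18) ^ 10 by ring,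
      show (1 / 10 : ℝ) = 1 / ((10 : ℕ) : ℝ) by norm_num]
    exact pow_rpow_one_div_natCast (by positivity) (by norm_num)
  rw [hm]
  have hrs0 : 0 ≤ r * s := by positivity
  have e1 : (r ^ 18) ^ 5 = r ^ 90 := by ring
  have e2 : (r ^ 18) ^ 4 = r ^ 72 := by ring
  rw [e1, e2]
  have h40 : ((t / (2 * π) * dn) ^ (1 / 140 : ℝ)) ^ 40 ≤ (r * s) ^ 40 :=
    pow_le_pow_left₀ hu0 hurs 40
  have h65 : ((t / (2 * π) * dn) ^ (1 / 140 : ℝ)) ^ 65 / r ^ 90 ≤ (r * s) ^ 65 / r ^ 90 :=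
    div_le_div_of_nonneg_right (pow_le_pow_left₀ hu0 hurs 65) (by positivity)
  have h56 : ((t / (2 * π) * dn) ^ (1 / 140 : ℝ)) ^ 56 / r ^ 72 ≤ (r * s) ^ 56 / r ^ 72 :=
    div_le_div_of_nonneg_right (pow_le_pow_left₀ hu0 hurs 56) (by positivity)
  linarith

/-- Pure bookkeeping for the Weyl step in the roots `r`, `s`: if `s²⁵ ≤ r⁶⁵`, `4r³⁶⁰ ≤ s¹⁸⁰`,
`s¹⁶ ≤ r⁵⁶`, `r, s ≥ 1`, `r¹⁴⁰ ≤ 2Hs⁴⁰`, `H > 0`, then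
`2(r¹⁸⁰)²/H + 2⁸² r¹⁸⁰ G ≤ (2⁴⁵ r¹¹⁰ s²⁰)²` for the quantity `G` of the previous lemma. [folklore] -/
theorem weyl_pure {r s H : ℝ} (hr1 : 1 ≤ r) (hs1 : 1 ≤ s) (hP1 : s ^ 25 ≤ r ^ 65)
    (hP2 : 4 * r ^ 360 ≤ s ^ 180) (hP3 : s ^ 16 ≤ r ^ 56) (hH : 0 < H)
    (hHr : r ^ 140 ≤ 2 * H * s ^ 40) :
    2 * (r ^ 180) ^ 2 / H + 2 ^ 82 * r ^ 180 * ((r * s) ^ 40 + (r * s) ^ 65 / r ^ 90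
      + Real.sqrt ((r ^ 180) ^ 3 / s ^ 180) + Real.log (16 * s ^ 180) + (r * s) ^ 56 / r ^ 72)
      ≤ (2 ^ 45 * (r ^ 110 * s ^ 20)) ^ 2 := by
  have hr0 : 0 < r := by linarith
  have hs0 : 0 < s := by linarith
  have hr2s : r ^ 2 ≤ s := by
    have : (r ^ 2) ^ 180 ≤ s ^ 180 := by
      rw [← pow_mul, show 2 * 180 = 360 by norm_num]
      nlinarith [pow_nonneg hr0.le 360]
    exact le_of_pow_le_pow_left₀ (by norm_num) hs0.le this
  set Z : ℝ := r ^ 220 * s ^ 40 with hZ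
  have hZ0 : 0 ≤ Z := by positivity
  have hT0 : 2 * (r ^ 180) ^ 2 / H ≤ 4 * Z := by
    rw [div_le_iff₀ hH]
    have h := mul_le_mul_of_nonneg_left hHr (by positivity : (0 : ℝ) ≤ 2 * r ^ 220)
    have e1 : 2 * r ^ 220 * r ^ 140 = 2 * (r ^ 180) ^ 2 := by ring
    have e2 : 2 * r ^ 220 * (2 * H * s ^ 40) = 4 * Z * H := by rw [hZ]; ring
    linarith
  have hG1 : r ^ 180 * (r * s) ^ 40 = Z := by rw [hZ]; ring
  have hG2 : r ^ 180 * ((r * s) ^ 65 / r ^ 90) ≤ Z := by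
    rw [show r ^ 180 * ((r * s) ^ 65 / r ^ 90) = (r ^ 155 * s ^ 40) * s ^ 25 by
      field_simp]
    calc (r ^ 155 * s ^ 40) * s ^ 25 ≤ (r ^ 155 * s ^ 40) * r ^ 65 :=
          mul_le_mul_of_nonneg_left hP1 (by positivity)
      _ = Z := by rw [hZ]; ring
  have hG3 : r ^ 180 * Real.sqrt ((r ^ 180) ^ 3 / s ^ 180) ≤ Z := by
    have h1 : Real.sqrt ((r ^ 180) ^ 3 / s ^ 180) = r ^ 270 / s ^ 90 := by
      rw [show (r ^ 180) ^ 3 / s ^ 180 = (r ^ 270 / s ^ 90) ^ 2 by field_simp]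
      exact Real.sqrt_sq (by positivity)
    rw [h1, show r ^ 180 * (r ^ 270 / s ^ 90) = r ^ 450 / s ^ 90 by ring,
      div_le_iff₀ (by positivity)]
    have h2 : r ^ 230 ≤ s ^ 130 := by
      calc r ^ 230 = (r ^ 2) ^ 115 := by ring
        _ ≤ s ^ 115 := pow_le_pow_left₀ (by positivity) hr2s 115
        _ ≤ s ^ 130 := pow_le_pow_right₀ hs1 (by norm_num)
    calc r ^ 450 = r ^ 220 * r ^ 230 := by ring
      _ ≤ r ^ 220 * s ^ 130 := mul_le_mul_of_nonneg_left h2 (by positivity)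
      _ = Z * s ^ 90 := by rw [hZ]; ring
  have hG4 : r ^ 180 * Real.log (16 * s ^ 180) ≤ 183 * Z := by
    have h16 : Real.log 16 ≤ 3 := by
      rw [show (16 : ℝ) = 2 ^ 4 by norm_num, Real.log_pow]
      have := Real.log_two_lt_d9
      push_cast
      linarith
    have hlogK : Real.log (s ^ 180) ≤ 180 * s := by
      rw [Real.log_pow]
      push_cast
      have := Real.log_le_sub_one_of_pos hs0
      nlinarith
    have h1 : Real.log (16 * s ^ 180) ≤ 183 * s := by
      rw [Real.log_mul (by norm_num) (by positivity)]
      linarith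
    have h2 : s ≤ s ^ 40 := le_self_pow₀ hs1 (by norm_num)
    have h3 : (1 : ℝ) ≤ r ^ 40 := one_le_pow₀ hr1
    have h4 : r ^ 180 * Real.log (16 * s ^ 180) ≤ r ^ 180 * (183 * s ^ 40) := by
      have := mul_le_mul_of_nonneg_left (h1.trans (by linarith : 183 * s ≤ 183 * s ^ 40))
        (by positivity : (0 : ℝ) ≤ r ^ 180)
      exact this
    have h5 : r ^ 180 * (183 * s ^ 40) ≤ r ^ 180 * (183 * s ^ 40) * r ^ 40 :=
      le_mul_of_one_le_right (by positivity) h3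
    have e : r ^ 180 * (183 * s ^ 40) * r ^ 40 = 183 * Z := by rw [hZ]; ring
    linarith
  have hG5 : r ^ 180 * ((r * s) ^ 56 / r ^ 72) ≤ Z := by
    rw [show r ^ 180 * ((r * s) ^ 56 / r ^ 72) = (r ^ 164 * s ^ 40) * s ^ 16 by
      field_simp]
    calc (r ^ 164 * s ^ 40) * s ^ 16 ≤ (r ^ 164 * s ^ 40) * r ^ 56 :=
          mul_le_mul_of_nonneg_left hP3 (by positivity)
      _ = Z := by rw [hZ]; ring
  have hexp : 2 ^ 82 * r ^ 180 * ((r * s) ^ 40 + (r * s) ^ 65 / r ^ 90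
      + Real.sqrt ((r ^ 180) ^ 3 / s ^ 180) + Real.log (16 * s ^ 180) + (r * s) ^ 56 / r ^ 72)
      = 2 ^ 82 * (r ^ 180 * (r * s) ^ 40 + r ^ 180 * ((r * s) ^ 65 / r ^ 90)
        + r ^ 180 * Real.sqrt ((r ^ 180) ^ 3 / s ^ 180) + r ^ 180 * Real.log (16 * s ^ 180)
        + r ^ 180 * ((r * s) ^ 56 / r ^ 72)) := by ring
  have hsq : (2 ^ 45 * (r ^ 110 * s ^ 20)) ^ 2 = 2 ^ 90 * Z := by rw [hZ]; ring
  rw [hexp, hsq]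
  linarith [hG1.le]

/-- **The exponent pair `(1/9, 13/18) = ABA²B(0,1)` for `∑ n^{it}` in the range
`K^{5/13} ≤ M ≤ K^{1/2}/2`** (`K = t/2π ≥ 1`, `M ≥ 512`): for integers `M/4 ≤ j`,
`j + M/4 ≤ f ≤ M`,
`‖∑_{j<n≤f} e((t/2π) log n)‖ ≤ 2⁴⁵ M^{11/18} K^{1/9}` (one Weyl differencing with
`H = ⌊M^{7/9}K^{-2/9}⌋`, then `Literature.NumberTheory.LFunctions.VdC.norm_sum_e_dphase_le` for
each shift). [cite: BourgainJAMS2017, §5 eq. (4.2)] [cite: Titchmarsh1986, §5.20] -/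
theorem norm_sum_e_phaseD_le_AB {t M : ℝ} {j f : ℕ} (ht : 0 < t) (hK1 : 1 ≤ t / (2 * π))
    (hM : 512 ≤ M) (hKM : (t / (2 * π)) ^ (5 / 13 : ℝ) ≤ M) (hMK : M ^ 2 ≤ t / (2 * π) / 4)
    (hj : M / 4 ≤ j) (hjf : (j : ℝ) + M / 4 ≤ f) (hfM : (f : ℝ) ≤ M) :
    ‖∑ n ∈ Finset.Ioc (j : ℤ) (f : ℤ), e (phaseD (-t) 0 n)‖
      ≤ 2 ^ 45 * M ^ (11 / 18 : ℝ) * (t / (2 * π)) ^ (1 / 9 : ℝ) := by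
  have hK0 : 0 < t / (2 * π) := by positivity
  have hM0 : 0 < M := by linarith
  have hM1 : 1 ≤ M := by linarith
  -- the roots `r = M^{1/180}`, `s = K^{1/180}`
  set r : ℝ := M ^ (1 / 180 : ℝ) with hr
  set s : ℝ := (t / (2 * π)) ^ (1 / 180 : ℝ) with hs
  have hr0 : 0 < r := Real.rpow_pos_of_pos hM0 _
  have hs0 : 0 < s := Real.rpow_pos_of_pos hK0 _
  have hr1 : 1 ≤ r := Real.one_le_rpow hM1 (by norm_num)
  have hs1 : 1 ≤ s := Real.one_le_rpow hK1 (by norm_num)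
  have hr180 : r ^ 180 = M := by
    rw [hr, show (1 / 180 : ℝ) = 1 / ((180 : ℕ) : ℝ) by norm_num]
    exact rpow_one_div_natCast_pow hM0.le (by norm_num)
  have hs180 : s ^ 180 = t / (2 * π) := by
    rw [hs, show (1 / 180 : ℝ) = 1 / ((180 : ℕ) : ℝ) by norm_num]
    exact rpow_one_div_natCast_pow hK0.le (by norm_num)
  -- rational powers of `M`, `K` as monomials in `r`, `s`
  have hrpow : ∀ (n : ℕ) (q : ℝ), (n : ℝ) / 180 = q → r ^ n = M ^ q := by
    intro n q hq
    rw [hr, ← Real.rpow_natCast, ← Real.rpow_mul hM0.le, ← hq]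
    congr 1; ring
  have hspow : ∀ (n : ℕ) (q : ℝ), (n : ℝ) / 180 = q → s ^ n = (t / (2 * π)) ^ q := by
    intro n q hq
    rw [hs, ← Real.rpow_natCast, ← Real.rpow_mul hK0.le, ← hq]
    congr 1; ring
  -- the hypotheses in polynomial form
  have hP1 : s ^ 25 ≤ r ^ 65 := by
    rw [hspow 25 (5 / 36) (by norm_num), hrpow 65 (13 / 36) (by norm_num)]
    have h1 : (t / (2 * π)) ^ (5 / 36 : ℝ) = ((t / (2 * π)) ^ (5 / 13 : ℝ)) ^ (13 / 36 : ℝ) := by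
      rw [← Real.rpow_mul hK0.le]; norm_num
    rw [h1]
    exact Real.rpow_le_rpow (by positivity) hKM (by norm_num)
  have hP2 : 4 * r ^ 360 ≤ s ^ 180 := by
    rw [show r ^ 360 = (r ^ 180) ^ 2 by ring, hr180, hs180]
    linarith
  have hP3 : s ^ 16 ≤ r ^ 56 := by
    rw [hspow 16 (4 / 45) (by norm_num), hrpow 56 (14 / 45) (by norm_num)]
    have h27 : (t / (2 * π)) ^ (2 / 7 : ℝ) ≤ M := by
      refine le_trans ?_ hKM
      exact Real.rpow_le_rpow_of_exponent_le hK1 (by norm_num)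
    have h1 : (t / (2 * π)) ^ (4 / 45 : ℝ) = ((t / (2 * π)) ^ (2 / 7 : ℝ)) ^ (14 / 45 : ℝ) := by
      rw [← Real.rpow_mul hK0.le]; norm_num
    rw [h1]
    exact Real.rpow_le_rpow (by positivity) h27 (by norm_num)
  have hP4 : 4 ≤ r ^ 40 := by
    rw [hrpow 40 (2 / 9) (by norm_num)]
    have h1 : (4 : ℝ) = (512 : ℝ) ^ (2 / 9 : ℝ) := by
      rw [show (512 : ℝ) = (2 : ℝ) ^ ((9 : ℕ) : ℝ) by norm_num, ← Real.rpow_mul (by norm_num),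
        show ((9 : ℕ) : ℝ) * (2 / 9 : ℝ) = ((2 : ℕ) : ℝ) by norm_num, Real.rpow_natCast]
      norm_num
    rw [h1]
    exact Real.rpow_le_rpow (by norm_num) hM (by norm_num)
  -- derived inequalities
  have hs5 : s ^ 5 ≤ r ^ 13 := by
    have : (s ^ 5) ^ 5 ≤ (r ^ 13) ^ 5 := by
      rw [← pow_mul, ← pow_mul]; exact hP1
    exact le_of_pow_le_pow_left₀ (by norm_num) (by positivity) this
  have hs40 : s ^ 40 ≤ r ^ 140 := by
    have h1 : s ^ 40 ≤ r ^ 104 := by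
      calc s ^ 40 = (s ^ 5) ^ 8 := by ring
        _ ≤ (r ^ 13) ^ 8 := pow_le_pow_left₀ (by positivity) hs5 8
        _ = r ^ 104 := by ring
    exact h1.trans (pow_le_pow_right₀ hr1 (by norm_num))
  -- the differencing parameter `H = ⌊r¹⁴⁰/s⁴⁰⌋ = ⌊M^{7/9}K^{-2/9}⌋`
  set Hr : ℝ := r ^ 140 / s ^ 40 with hHr
  have hHr1 : 1 ≤ Hr := by rw [hHr, le_div_iff₀ (by positivity)]; linarith
  have hHrM : Hr ≤ M / 4 := by
    have h1 : Hr ≤ r ^ 140 := div_le_self (by positivity) (one_le_pow₀ hs1)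
    have h2 : 4 * r ^ 140 ≤ r ^ 180 := by
      calc 4 * r ^ 140 ≤ r ^ 40 * r ^ 140 := mul_le_mul_of_nonneg_right hP4 (by positivity)
        _ = r ^ 180 := by ring
    rw [← hr180]; linarith
  set H : ℕ := ⌊Hr⌋₊ with hH
  have hH1 : 1 ≤ H := Nat.le_floor (by exact_mod_cast hHr1)
  have hHle : (H : ℝ) ≤ Hr := Nat.floor_le (by linarith)
  have hHge : Hr / 2 ≤ H := half_le_natFloor hHr1
  have hHpos : (0 : ℝ) < H := by exact_mod_cast hH1
  have hfj : M / 4 ≤ (f : ℝ) - j := by linarith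
  have hHL : (H : ℤ) ≤ (f : ℤ) - (j : ℤ) := by
    have h1 : (H : ℝ) ≤ (f : ℝ) - (j : ℝ) := hHle.trans (hHrM.trans hfj)
    have h2 : ((H : ℤ) : ℝ) ≤ (((f : ℤ) - (j : ℤ) : ℤ) : ℝ) := by push_cast; exact h1
    exact_mod_cast h2
  -- Step 1: Weyl–van der Corput differencing
  have hW := vanDerCorput_e (fun y : ℝ => phaseD (-t) 0 y) (a := (j : ℤ)) (b := (f : ℤ)) hH1 hHL
  beta_reduce at hW
  -- Step 2: each differenced sum
  set G : ℝ := (r * s) ^ 40 + (r * s) ^ 65 / r ^ 90 + Real.sqrt (M ^ 3 / (t / (2 * π)))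
    + Real.log (16 * (t / (2 * π))) + (r * s) ^ 56 / r ^ 72 with hG
  have hlog0 : 0 ≤ Real.log (16 * (t / (2 * π))) := Real.log_nonneg (by linarith)
  have hG0 : 0 ≤ G := by positivity
  have hterm : ∀ dd ∈ Finset.Ico (1 : ℤ) H,
      ‖∑ n ∈ Finset.Ioc (j : ℤ) ((f : ℤ) - dd),
          e (phaseD (-t) 0 ((n + dd : ℤ)) - phaseD (-t) 0 n)‖ ≤ 2 ^ 80 * G := by
    intro dd hdd
    rw [Finset.mem_Ico] at hdd
    obtain ⟨dn, rfl⟩ : ∃ dn : ℕ, dd = dn := ⟨dd.toNat, (Int.toNat_of_nonneg (by omega)).symm⟩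
    have hdn1 : 1 ≤ dn := by exact_mod_cast hdd.1
    have hdnH : dn + 1 ≤ H := by exact_mod_cast hdd.2
    have hdnR : (dn : ℝ) ≤ Hr := by
      have : (dn : ℝ) + 1 ≤ H := by exact_mod_cast hdnH
      linarith
    have hdnM : (dn : ℝ) ≤ M / 4 := hdnR.trans hHrM
    have hdnf : (j : ℝ) + dn ≤ f := by linarith
    -- `u ≤ rs`
    have hKd : 0 < t / (2 * π) * dn := by positivity
    have hurs : (t / (2 * π) * dn) ^ (1 / 140 : ℝ) ≤ r * s := by
      have h1 : t / (2 * π) * dn ≤ (r * s) ^ 140 := by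
        calc t / (2 * π) * dn ≤ t / (2 * π) * Hr := mul_le_mul_of_nonneg_left hdnR hK0.le
          _ = (r * s) ^ 140 := by
              rw [← hs180, hHr, mul_div_assoc', div_eq_iff (by positivity), mul_pow]
              ring
      calc (t / (2 * π) * dn) ^ (1 / 140 : ℝ) ≤ ((r * s) ^ 140) ^ (1 / 140 : ℝ) :=
            Real.rpow_le_rpow hKd.le h1 (by norm_num)
        _ = r * s := by
            rw [show (1 / 140 : ℝ) = 1 / ((140 : ℕ) : ℝ) by norm_num]
            exact pow_rpow_one_div_natCast (by positivity) (by norm_num)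
    exact norm_diff_sum_le ht hK1 (by linarith) hMK hj hfM hdn1 hdnM hdnf hr0 hs0 hr180 hurs
  -- Step 3: summing over the shifts
  have hsumd : ∑ dd ∈ Finset.Ico (1 : ℤ) H,
      ‖∑ n ∈ Finset.Ioc (j : ℤ) ((f : ℤ) - dd),
          e (phaseD (-t) 0 ((n + dd : ℤ)) - phaseD (-t) 0 n)‖ ≤ H * (2 ^ 80 * G) := by
    refine (Finset.sum_le_sum hterm).trans ?_
    rw [Finset.sum_const, nsmul_eq_mul, Int.card_Ico]
    have : ((H : ℤ) - 1).toNat ≤ H := by omega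
    have h2 : ((((H : ℤ) - 1).toNat : ℕ) : ℝ) ≤ H := by exact_mod_cast this
    exact mul_le_mul_of_nonneg_right h2 (by positivity)
  set L : ℝ := ((f : ℤ) : ℝ) - ((j : ℤ) : ℝ) with hL
  have hL0 : 0 ≤ L := by rw [hL]; push_cast; linarith
  have hLM : L ≤ M := by
    rw [hL]; push_cast
    have : (0 : ℝ) ≤ j := Nat.cast_nonneg j
    linarith
  have hsq : ‖∑ n ∈ Finset.Ioc (j : ℤ) (f : ℤ), e (phaseD (-t) 0 n)‖ ^ 2
      ≤ 2 * M ^ 2 / H + 2 ^ 82 * M * G := by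
    refine hW.trans ?_
    have h1 : 2 * L ^ 2 / H ≤ 2 * M ^ 2 / H := by
      apply div_le_div_of_nonneg_right _ hHpos.le
      nlinarith
    have h2 : 4 * L / H * ∑ dd ∈ Finset.Ico (1 : ℤ) H,
        ‖∑ n ∈ Finset.Ioc (j : ℤ) ((f : ℤ) - dd),
          e (phaseD (-t) 0 ((n + dd : ℤ)) - phaseD (-t) 0 n)‖ ≤ 2 ^ 82 * M * G := by
      have h3 : 4 * L / H * ∑ dd ∈ Finset.Ico (1 : ℤ) H,
          ‖∑ n ∈ Finset.Ioc (j : ℤ) ((f : ℤ) - dd),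
            e (phaseD (-t) 0 ((n + dd : ℤ)) - phaseD (-t) 0 n)‖
          ≤ 4 * L / H * (H * (2 ^ 80 * G)) :=
        mul_le_mul_of_nonneg_left hsumd (by positivity)
      have h4 : 4 * L / H * (H * (2 ^ 80 * G)) = 4 * L * (2 ^ 80 * G) := by
        field_simp
      have h5 : 4 * L * (2 ^ 80 * G) ≤ 4 * M * (2 ^ 80 * G) :=
        mul_le_mul_of_nonneg_right (by linarith) (by positivity)
      linarith
    linarith
  -- Step 4: bookkeeping in `r`, `s`
  have hHr2 : r ^ 140 ≤ 2 * H * s ^ 40 := by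
    have h1 : Hr ≤ 2 * H := by linarith
    rw [hHr, div_le_iff₀ (by positivity)] at h1
    linarith
  have hpure := weyl_pure hr1 hs1 hP1 hP2 hP3 hHpos hHr2
  rw [hr180, hs180] at hpure
  have htot : ‖∑ n ∈ Finset.Ioc (j : ℤ) (f : ℤ), e (phaseD (-t) 0 n)‖ ^ 2
      ≤ (2 ^ 45 * (r ^ 110 * s ^ 20)) ^ 2 := by
    refine hsq.trans (le_trans (le_of_eq ?_) hpure)
    rw [hG]
  -- Step 5: take square roots and return to `M`, `K`
  have hfin : ‖∑ n ∈ Finset.Ioc (j : ℤ) (f : ℤ), e (phaseD (-t) 0 n)‖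
      ≤ 2 ^ 45 * (r ^ 110 * s ^ 20) :=
    le_of_pow_le_pow_left₀ (by norm_num) (by positivity) htot
  rw [hrpow 110 (11 / 18) (by norm_num), hspow 20 (1 / 9) (by norm_num)] at hfin
  calc _ ≤ 2 ^ 45 * (M ^ (11 / 18 : ℝ) * (t / (2 * π)) ^ (1 / 9 : ℝ)) := hfin
    _ = 2 ^ 45 * M ^ (11 / 18 : ℝ) * (t / (2 * π)) ^ (1 / 9 : ℝ) := by ring

end VdC
end Literature.NumberTheory.LFunctions

end
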